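import Mathlib
import Literature.NumberTheory.Transcendental.RoyCriterion
import Literature.NumberTheory.Transcendental.RoySmallValueEstimates
import Literature.NumberTheory.Transcendental.QuadraticRelationsLogarithmsWeilHeight
import Summits.Schanuel.Schanuel.Theses.RoyCriterion

/-!
# Sketch — crux `RoySmallValueDirichletGap` (item stmt-Schanuel-1050), crux-ideate round 1, ideator 3

First-lemma signatures for the idea cards in `Ideas/`:

* card `leaf-quotient-hermite-lindemann` : `NesterenkoWaldschmidt1996` (named-fact shape of the
  input), `LeafQuotientRigidity` (FIRST LEMMA), `RoyExponentNotSharp` (the unconditional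
  deliverable of the line: Roy's exponent `(τ-1)(2-τ)/(β+1-τ)` is not sharp anywhere on
  `1 < τ < 2`), `royNWExponent` (expected new exponent in the generic branch),
  `LinearHermiteLindemann μ` (the conjectural input under which the line closes the whole crux for
  `τ ≥ (4μ+1)/(2μ+1)`), and the sandwich `crux → RoyExponentNotSharp`.
* card `polar-body-transference` : `JetSpanDual` (FIRST LEMMA: the transference dual of the
  small-value hypothesis at one level).
-/

noncomputable section

namespace Summit.Schanuel.Schanuel.Cruxes.RoySmallValueDirichletGap.Sketch

open Literature.NumberTheory.Transcendental

/-! ### Card A — leaf-quotient + Hermite–Lindemann measure -/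

/-- Named-fact shape of Nesterenko–Waldschmidt 1996, Main Theorem (arXiv:math/0002047, Thm 1,
p. 1; refined without explicit constant as Thm 4.2 of Waldschmidt's Cetraro lectures, LNM 1819
p. 297): for `θ ≠ 0`, algebraic `a, b`, `D = [ℚ(a,b):ℚ]`, `E ≥ e`, `log A ≥ max(h(a), 1/D)`,
`log B ≥ h(b)`:
`|e^θ - a| + |θ - b| ≥ exp(-211 D (log B + log log A + 4 log D + 2 log(E max(1,|θ|)) + 10)
 (D log A + 2E|θ| + 6 log E)(3.3 D log(D+2) + log E)(log E)^{-2})`. -/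
def NesterenkoWaldschmidt1996 : Prop :=
  ∀ (θ : ℂ), θ ≠ 0 → ∀ (a b : ℂ), IsAlgebraic ℚ a → IsAlgebraic ℚ b →
    ∀ (A B E : ℝ), Real.exp 1 ≤ E → 1 < A → 1 ≤ B →
      max (weilHeight₁ (IntermediateField.adjoin ℚ ({a, b} : Set ℂ)) (fun _ : Unit => a))
          ((Module.finrank ℚ ↥(IntermediateField.adjoin ℚ ({a, b} : Set ℂ)) : ℝ)⁻¹) ≤ Real.log A →
      weilHeight₁ (IntermediateField.adjoin ℚ ({a, b} : Set ℂ)) (fun _ : Unit => b) ≤ Real.log B →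
      let D : ℝ := (Module.finrank ℚ ↥(IntermediateField.adjoin ℚ ({a, b} : Set ℂ)) : ℝ)
      Real.exp (-(211 * D *
          (Real.log B + Real.log (Real.log A) + 4 * Real.log D + 2 * Real.log (E * max 1 ‖θ‖) + 10) *
          (D * Real.log A + 2 * E * ‖θ‖ + 6 * Real.log E) *
          (3.3 * D * Real.log (D + 2) + Real.log E) / (Real.log E) ^ 2))
        ≤ ‖Complex.exp θ - a‖ + ‖θ - b‖

/-- **FIRST LEMMA (leaf-quotient rigidity).** Two DISTINCT algebraic points `(x,y), (x',y')` of
`𝔾ₐ × 𝔾ₘ`, both within `ε` (Roy's vertical distance `|y - η e^{x-ξ}|`, Roy 2013 §4) of the SAME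
translate `A_γ = {(ξ+z, ηe^z)}` of the exponential curve and both within `ρ` of `γ = (ξ,η)`,
force `log(1/ε) ≲ D³ log(D+2) H + D²H²/log(1/ρ) + D³ log(D+2) H²/log(1/ρ)²`
(`D` = degree of the compositum, `H` ≥ affine absolute log Weil heights). Proof route: the group
quotient `(a, b) = (x - x', y/y')` satisfies `|Log b - a| ≤ C(ε+ε')`, `|a| ≤ 2ρ`; Liouville if
`a = 0` or `b = 1`; otherwise `NesterenkoWaldschmidt1996` with `θ = Log b`, `E = D log A/|θ|`
(so `log E ≈ log(1/ρ)` is the gain). No Roy machinery: pure Hermite–Lindemann-measure content. -/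
def LeafQuotientRigidity : Prop :=
  ∀ (ξ η : ℂ), η ≠ 0 → ∃ c : ℝ, 0 < c ∧
    ∀ (x y x' y' : ℂ), IsAlgebraic ℚ x → IsAlgebraic ℚ y → IsAlgebraic ℚ x' → IsAlgebraic ℚ y' →
      (x, y) ≠ (x', y') →
      ∀ (D H ε ρ : ℝ),
        (Module.finrank ℚ ↥(IntermediateField.adjoin ℚ ({x, y, x', y'} : Set ℂ)) : ℝ) ≤ D →
        1 ≤ H →
        weilHeight₁ (IntermediateField.adjoin ℚ ({x, y, x', y'} : Set ℂ)) ![x, y] ≤ H →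
        weilHeight₁ (IntermediateField.adjoin ℚ ({x, y, x', y'} : Set ℂ)) ![x', y'] ≤ H →
        0 < ε → ε ≤ c⁻¹ → 0 < ρ → ρ ≤ c⁻¹ →
        ‖y - η * Complex.exp (x - ξ)‖ ≤ ε → ‖y' - η * Complex.exp (x' - ξ)‖ ≤ ε →
        ‖x - ξ‖ ≤ ρ → ‖x' - ξ‖ ≤ ρ →
        Real.log ε⁻¹ ≤ c * (D ^ 3 * Real.log (D + 2) * H + D ^ 2 * H ^ 2 / Real.log ρ⁻¹
          + D ^ 3 * Real.log (D + 2) * H ^ 2 / (Real.log ρ⁻¹) ^ 2)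

/-- Roy's printed gap exponent `(τ-1)(2-τ)/(β+1-τ)` (Roy 2013 Thm 1.1). -/
def royExponent (β τ : ℝ) : ℝ := (τ - 1) * (2 - τ) / (β + 1 - τ)

/-- The exponent this line expects in the generic branch (bilinear/`L` branch of
`LeafQuotientRigidity` against Roy's enemy bounds): `2.5 (2-τ)(τ-1)/(2+3β-2τ)`; always
`< royExponent β τ` (ratio `2.5(β+1-τ)/(2+3β-2τ) ∈ (0.625, 0.834)`), e.g. `(τ,β)=(1.5,2)`:
`0.1667 ↦ 0.125`. For small `τ, β` the cubic branch may bind and the admissible value is the larger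
root described on the card; the deliverable below is therefore stated existentially. -/
def royNWExponent (β τ : ℝ) : ℝ := 5 * (2 - τ) * (τ - 1) / (2 * (2 + 3 * β - 2 * τ))

/-- The small-value hypothesis of the crux at one point and parameters (verbatim sub-formula of
`Summit.Schanuel.Schanuel.Theses.RoyCriterion.RoySmallValueDirichletGap`). -/
def RoyHyp (ξ η : ℂ) (β τ ν : ℝ) : Prop :=
  ∀ᶠ D : ℕ in Filter.atTop, ∃ P : MvPolynomial (Fin 2) ℤ, P ≠ 0 ∧ P.totalDegree ≤ D ∧
    (mvPolyHeight P : ℝ) ≤ Real.exp ((D : ℝ) ^ β) ∧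
    ∀ i : ℕ, i < 3 * ⌊(D : ℝ) ^ τ⌋₊ →
      ‖MvPolynomial.aeval ![ξ, η] (royD^[i] P)‖ ≤ Real.exp (-(D : ℝ) ^ ν)

/-- **Deliverable of the line (unconditional): Roy's exponent is not sharp anywhere.** For every
`1 < τ < 2`, `β > τ` there is `δ₁ < (τ-1)(2-τ)/(β+1-τ)` such that the one-point small value
estimate holds for `ν > 2 + β - τ + δ₁`. Sandwiched: crux ⇒ this ⇒ `roy2013_thm_1_1` on `τ > 1`. -/
def RoyExponentNotSharp : Prop :=
  ∀ (β τ : ℝ), 1 < τ → τ < 2 → τ < β → ∃ δ₁ : ℝ, δ₁ < royExponent β τ ∧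
    ∀ (ξ η : ℂ), η ≠ 0 → ∀ ν : ℝ, 2 + β - τ + δ₁ < ν → RoyHyp ξ η β τ ν →
      IsAlgebraic ℚ ξ ∧ IsAlgebraic ℚ η

/-- The conjectural input closing the whole crux on `τ ≥ (4μ+1)/(2μ+1)` (and improving `δ₁`
everywhere): a Hermite–Lindemann measure LINEAR in the heights (Waldschmidt, Cetraro LNM 1819
§4.1: the linear estimates (4.1)/(4.2) and Mahler's problem Conj. 4.1 are open even for integers;
best known is bilinear = `NesterenkoWaldschmidt1996`). -/
def LinearHermiteLindemann (μ : ℝ) : Prop :=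
  ∃ C : ℝ, 0 < C ∧ ∀ (a b : ℂ), IsAlgebraic ℚ a → IsAlgebraic ℚ b → a ≠ 0 →
    ∀ (θ : ℂ), Complex.exp θ = b → θ ≠ 0 → ‖θ‖ ≤ 1 →
      let F := IntermediateField.adjoin ℚ ({a, b} : Set ℂ)
      let D : ℝ := (Module.finrank ℚ ↥F : ℝ)
      let H : ℝ := 1 + weilHeight₁ F (fun _ : Unit => a) + weilHeight₁ F (fun _ : Unit => b)
      Real.exp (-(C * D ^ μ * H * (1 + Real.log (D * H)))) ≤ ‖θ - a‖

/-- Sandwich, upper half: the crux (Dirichlet edge) implies the line's deliverable. -/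
theorem royExponentNotSharp_of_crux
    (h : Summit.Schanuel.Schanuel.Theses.RoyCriterion.RoySmallValueDirichletGap) :
    RoyExponentNotSharp := by
  intro β τ hτ1 hτ2 hβ
  refine ⟨0, ?_, ?_⟩
  · unfold royExponent
    apply div_pos
    · nlinarith
    · linarith
  · intro ξ η hη ν hν hyp
    exact h ξ η hη β τ ν hτ1.le hτ2 hβ (by linarith) hyp

/-! ### Card B — polar-body transference (dual small value estimate) -/

/-- The `3⌊D^τ⌋` jet functionals at `γ` on integer forms of degree `≤ D`, packaged as the linear
map `P ↦ (𝒟ⁱP(ξ,η))_{i}` on coefficient vectors; here only through its values on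
`MvPolynomial (Fin 2) ℤ`. **FIRST LEMMA (transference dual, one level):** if the small-value
hypothesis holds at level `D` (large) with `ν > 2+β-τ`, `β > 1`, then there is a nonzero
INTEGER-valued additive functional `Y` on `ℤ[X₁,X₂]_{≤ D}` and complex weights `c_i`
(`i < 3⌊D^τ⌋`) with `|Y(P) - Re ∑ c_i 𝒟ⁱP(ξ,η)| ≤ exp(-κ D^{β+δ}) ‖P‖` for all integer `P` of
degree `≤ D` and `|c_i| ≤ exp(2 D^ν)` — Banaszczyk's transference `λ_i(K)λ_{N-i+1}(K°) ≤ C N log N`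
in dimension `N = binom(D+2,2)` costs only `exp(O(D² log D)) = exp(o(D^{2+β}))` because `β > 1`. -/
def JetSpanDual : Prop :=
  ∀ (ξ η : ℂ), η ≠ 0 → ∀ (β τ ν : ℝ), 1 < τ → τ < 2 → τ < β → 2 + β - τ < ν →
    RoyHyp ξ η β τ ν → ∃ κ : ℝ, 0 < κ ∧
      ∀ᶠ D : ℕ in Filter.atTop, ∃ (Y : MvPolynomial (Fin 2) ℤ →+ ℤ) (c : ℕ → ℂ),
        (∃ P : MvPolynomial (Fin 2) ℤ, P.totalDegree ≤ D ∧ Y P ≠ 0) ∧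
        (∀ i, ‖c i‖ ≤ Real.exp (2 * (D : ℝ) ^ ν)) ∧
        ∀ P : MvPolynomial (Fin 2) ℤ, P.totalDegree ≤ D →
          |(Y P : ℝ) - (∑ i ∈ Finset.range (3 * ⌊(D : ℝ) ^ τ⌋₊),
              c i * MvPolynomial.aeval ![ξ, η] (royD^[i] P)).re|
            ≤ Real.exp (-(κ * (D : ℝ) ^ (ν + τ - 2))) * (mvPolyHeight P : ℝ)

end Summit.Schanuel.Schanuel.Cruxes.RoySmallValueDirichletGap.Sketch

end
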